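import Summits.HodgeConjecture.HodgeConjecture.Theorems.K2E1TraceFormulaBetaDefs   -- ★ p854778 (K2E1-p01): `StGlobKit`, `Law…`, `E1St1383Letter`
import HarnessLib

/-!
# K2·E1 — row 22 «ReadOffAtPlace», SCAFFOLD: the global index of (13.8.3) from a finite LEVEL CUT — the kit laws are bookkeeping, the one remaining
# input is the IDENTITY at `v`; `E1St1383Letter` from «∃ automorphic `μG` + finite level cut `C` with signs `ε = ±1`, multiplicities `m ≥ 1` + the identity at `v`»

Cell `hodgecm-mathlib`, Track B ∕ K2-LIT, squad K2, ENGINE E1 (line `K2_E1_TraceFormulaBeta`, TABLE row 22); crux H413 = `stmt-HodgeConjecture-24833` (route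
`HCCMUnconditional`); seat K2E1-p09 (g0), DEAL K2E1-plan (g0) 2026-09-03T22:03:31Z `K2E1StGlobKitOfLevelCut`.  PROOF FILE, lane `--supports stmt-HodgeConjecture-24833
--as helper`: THEOREMS ONLY — no definition (the level-cut kit is built INLINE, as an anonymous `StGlobKit` term, inside the proofs), no instance, no notation, no named
fact, no `sorry`.  Closes no socket.  HONEST LABEL: HC_CM is proved only modulo the 7 printed citations (2 remaining named inputs: hLiu418 = `stmt-HodgeConjecture-24832`,
h413 = `stmt-HodgeConjecture-24833`) until rung 0 closes; nothing here changes that count.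

WHAT.  ★ `E1St1383Letter` (the engine socket `stub_E1_St1383` of the tier-0 line) asks for an automorphic measure `μG` on `U(Φ₃)(L⁺)\U(Φ₃)(𝔸_{L⁺})` and an index
`𝔨 : StGlobKit L` (fields `Idx`, `mult`, `loc`, `eps`) with the laws COUNTABLE · DISCRETE · SIGNS · FINITE FIBRES and the identity «`Σ' m(π) ε_π Tr π_v(φ) = Tr St_H(ξ_v)(f^H)`»
at `v` [Rogawski1990, §13.8 p. 219].  In print the index is a FINITE set of discrete automorphic `π` (those unramified off `v`, in the pinned archimedean packets, below a
fixed level: K2E1-p08's ★ `HCFinitenessU3` shape); for such a LEVEL CUT (a finite index `ι` of occurring families `loc i` of local classes, with `m : ι → ℕ`, `ε : ι → ℤ`) the four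
laws are AUTOMATIC, and the engine's real debt is the identity alone.  This file proves exactly that:

* §1 (any kit) `lawCountable_of_finite`, `lawFibreFinite_of_finite` — a kit with FINITE index satisfies COUNTABLE and FINITE FIBRES at every place.
* §2 (the level-cut kit `⟨ι, m, loc, ε⟩`, built inline; `ι : Type` small and finite — the families themselves live in `Type 1`, so the cut is indexed, as in
  K2E1-p08's ★ small index) `exists_lawful_kit_of_levelCut` — for `ι` finite, every `loc i` occurring (★ `cmOccursInDiscreteSpectrum … μG`),
  `0 < m`, `ε = ±1`, and ANY predicate `P` on kits holding for the level-cut kit: `∃ 𝔨, LawCountable ∧ LawDiscrete μG ∧ LawSigns ∧ LawFibreFinite v ∧ P 𝔨` — the shape of the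
  conclusion of ★ `E1St1383Letter` with `P` := its identity clause; `exists_measure_kit_of_levelCut` — the same with the measure packed (`∃ μG _ 𝔨, …`).
* §3 **`e1St1383Letter_of_levelCut_identity`** — ★ `E1St1383Letter` BY NAME from the LEVEL-CUT LETTER: its prefix copied VERBATIM from the leaf, its conclusion replaced
  by «∃ `μG` automorphic, `ι` finite, `loc`, `m`, `ε` with (occurring ∧ `0 < m`), `ε = ±1`, and the identity at `v` summed over `ι`».  This is the input K2E1-p08's finiteness
  (`HCFinitenessU3`) and the engine's (13.8.3) at `v` feed; nothing else of row 22 remains on the kit side.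

References: [Rogawski1990] J. Rogawski, Ann. of Math. Stud. 123 (1990), §13.8 Prop. 13.8.3 (proof) pp. 218–219, display (13.8.3).  [BorelJacquet1979] A. Borel,
H. Jacquet, PSPM 33.1 (1979), §4.6 (finiteness of automorphic representations of bounded level and archimedean type).
-/

set_option autoImplicit false
-- the mandated namespace has the single-problem summit's repeated segment (`HodgeConjecture.HodgeConjecture`)
set_option linter.dupNamespace false

noncomputable section

open NumberField IsDedekindDomain MeasureTheory
open scoped Matrix MatrixGroups
open Literature.NumberTheory.Rogawski1990 Literature.NumberTheory.Automorphic Literature.NumberTheory.Automorphic.UnitaryGroup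
open Literature.NumberTheory.Automorphic.UnitaryGroup.CotangentForms Literature.NumberTheory.GaloisRepresentations
open Literature.NumberTheory.Automorphic.Arthur2013.Leaves.TECR
open Summit.HodgeConjecture.HodgeConjecture.Cruxes.H413.F0P3GlobalPacketDiscrete (cmOccursInDiscreteSpectrum isUnitarizable_of_cmOccursInDiscreteSpectrum)
open Summit.HodgeConjecture.HodgeConjecture.Cruxes.H413.K2E1TraceFormulaBeta

namespace Summit.HodgeConjecture.HodgeConjecture.Cruxes.H413.K2E1StGlobKitOfLevelCut

/-! ## §1 Kits with finite index: COUNTABLE and FINITE FIBRES are automatic -/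

section FiniteIndex

variable {L : Type} [Field L] [NumberField L] [IsCMField L] (𝔨 : StGlobKit L)

/-- A kit with FINITE index satisfies the law COUNTABLE. [cite: BorelJacquet1979, §4.6] -/
theorem lawCountable_of_finite (h : Finite 𝔨.Idx) : 𝔨.LawCountable := by
  unfold StGlobKit.LawCountable
  infer_instance

/-- A kit with FINITE index satisfies the law FINITE FIBRES at every place `v`. [cite: Rogawski1990, §13.8 p. 219] [cite: BorelJacquet1979, §4.6] -/
theorem lawFibreFinite_of_finite (h : Finite 𝔨.Idx) (v : Pl L) : 𝔨.LawFibreFinite v :=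
  fun _ => Set.toFinite _

end FiniteIndex

/-! ## §2 The level-cut kit (inline): all four laws, and any property of the kit, packaged in the shape of the socket's conclusion -/

section LevelCut

variable {L : Type} [Field L] [NumberField L] [IsCMField L]

/-- **The LEVEL-CUT kit is lawful.**  Let `μG` be an automorphic measure on `U(Φ₃)(L⁺)\U(Φ₃)(𝔸_{L⁺})`, `ι` a FINITE (small) index of the cut with its families of finite
local classes `loc : ι → Π_u Irr(U(Φ₃)(L⁺_u))` each OCCURRING in the discrete spectrum (★ `cmOccursInDiscreteSpectrum L 3 (qsForm L) μG`; a small index exists for the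
occurring families, K2E1-p08's ★ smallness), `m : ι → ℕ` positive multiplicities and `ε : ι → ℤ` signs `±1`.  Then the kit `⟨ι, m, loc, ε⟩` satisfies COUNTABLE · DISCRETE ·
SIGNS · FINITE FIBRES (at every `v`), and any predicate `P` holding for it is carried along: `∃ 𝔨, … ∧ P 𝔨` — the conclusion shape of ★ `E1St1383Letter` with `P` := its
identity clause at `v`. [cite: Rogawski1990, §13.8 Prop. 13.8.3 (proof) pp. 218–219] [cite: BorelJacquet1979, §4.6] -/
theorem exists_lawful_kit_of_levelCut
    (μG : Measure (adelicGroupData (↥(maximalRealSubfield L)) L (IsCMField.complexConj L) 3 (qsForm L)).automorphicQuotient)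
    [(adelicGroupData (↥(maximalRealSubfield L)) L (IsCMField.complexConj L) 3 (qsForm L)).IsAutomorphicMeasure μG]
    {ι : Type} (hι : Finite ι) (loc : ι → ∀ u : Pl L, IrrClass (Gqs L u)) (m : ι → ℕ) (ε : ι → ℤ)
    (hocc : ∀ i, cmOccursInDiscreteSpectrum L 3 (qsForm L) μG (loc i)) (hm : ∀ i, 0 < m i) (hε : ∀ i, ε i = 1 ∨ ε i = -1) (v : Pl L)
    (P : StGlobKit L → Prop) (hP : P ⟨ι, m, loc, ε⟩) :
    ∃ 𝔨 : StGlobKit L, 𝔨.LawCountable ∧ 𝔨.LawDiscrete μG ∧ 𝔨.LawSigns ∧ 𝔨.LawFibreFinite v ∧ P 𝔨 :=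
  ⟨⟨ι, m, loc, ε⟩, lawCountable_of_finite _ hι, fun i => ⟨hocc i, hm i⟩, hε, lawFibreFinite_of_finite _ hι v, hP⟩

/-- **The same with the automorphic measure packed**: `∃ μG _ 𝔨, laws ∧ P 𝔨` — literally the shape of the conclusion of ★ `E1St1383Letter`.
[cite: Rogawski1990, §13.8 Prop. 13.8.3 (proof) pp. 218–219] -/
theorem exists_measure_kit_of_levelCut
    (μG : Measure (adelicGroupData (↥(maximalRealSubfield L)) L (IsCMField.complexConj L) 3 (qsForm L)).automorphicQuotient)
    (hμG : (adelicGroupData (↥(maximalRealSubfield L)) L (IsCMField.complexConj L) 3 (qsForm L)).IsAutomorphicMeasure μG)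
    {ι : Type} (hι : Finite ι) (loc : ι → ∀ u : Pl L, IrrClass (Gqs L u)) (m : ι → ℕ) (ε : ι → ℤ)
    (hocc : ∀ i, cmOccursInDiscreteSpectrum L 3 (qsForm L) μG (loc i)) (hm : ∀ i, 0 < m i) (hε : ∀ i, ε i = 1 ∨ ε i = -1) (v : Pl L)
    (P : StGlobKit L → Prop) (hP : P ⟨ι, m, loc, ε⟩) :
    ∃ (μG' : Measure (adelicGroupData (↥(maximalRealSubfield L)) L (IsCMField.complexConj L) 3 (qsForm L)).automorphicQuotient)
      (_ : (adelicGroupData (↥(maximalRealSubfield L)) L (IsCMField.complexConj L) 3 (qsForm L)).IsAutomorphicMeasure μG')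
      (𝔨 : StGlobKit L), 𝔨.LawCountable ∧ 𝔨.LawDiscrete μG' ∧ 𝔨.LawSigns ∧ 𝔨.LawFibreFinite v ∧ P 𝔨 :=
  ⟨μG, hμG, exists_lawful_kit_of_levelCut μG hι loc m ε hocc hm hε v P hP⟩

/-- **The fields of the level-cut kit** (definitional unfolding, recorded for the assembler: `Idx = ι`, `mult = m`, `eps = ε`, `loc = loc`).
[cite: Rogawski1990, §13.8 display (13.8.3) p. 218] -/
theorem levelCut_kit_fields {ι : Type} (loc : ι → ∀ u : Pl L, IrrClass (Gqs L u)) (m : ι → ℕ) (ε : ι → ℤ) :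
    (⟨ι, m, loc, ε⟩ : StGlobKit L).Idx = ι ∧ (∀ i, (⟨ι, m, loc, ε⟩ : StGlobKit L).mult i = m i) ∧
      (∀ i, (⟨ι, m, loc, ε⟩ : StGlobKit L).eps i = ε i) ∧ (∀ i u, (⟨ι, m, loc, ε⟩ : StGlobKit L).loc i u = loc i u) :=
  ⟨rfl, fun _ => rfl, fun _ => rfl, fun _ _ => rfl⟩

end LevelCut

/-! ## §3 `E1St1383Letter` BY NAME from the level-cut letter -/

/-- **★ `E1St1383Letter` FROM THE LEVEL-CUT LETTER.**  If, under the prefix of the letter (copied VERBATIM from ★ `K2E1TraceFormulaBetaDefs`: CM field `L`, unitary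
`μ` restricting to `ω_{L/L⁺}`, `ξ`, a finite place `v` non-split in `L`, Haar measures and canonical orbital families on `H_v` and `U(Φ₃)(L⁺_v)`, the labels `π₁`, `πSt`),
there are an automorphic measure `μG`, a FINITE (small) index `ι` of the level cut with families of finite local classes `loc i` each occurring in the discrete
spectrum for `μG`, positive multiplicities `m : ι → ℕ`, signs `ε : ι → {±1}`, such that for every smooth Δ‴_{Φ₃}-matched pair `(f^H, φ)` at `v` the FINITE-INDEX identity
«`Σ'_{i} m_i ε_i Tr (loc i)_v(φ) = Tr St_H(ξ_v)(f^H)`» holds (with its summability clause, automatic on a finite index but kept in the socket's shape) — THEN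
`E1St1383Letter` (kit := the level cut; laws by §2).  The engine's debt for row 22 is thereby exactly: the finiteness of the cut (K2E1-p08's `HCFinitenessU3`) and
the identity (13.8.3) read at `v` for it. [cite: Rogawski1990, §13.8 Prop. 13.8.3 (proof) pp. 218–219, display (13.8.3)] [cite: BorelJacquet1979, §4.6] -/
theorem e1St1383Letter_of_levelCut_identity
    (H : ∀ (L : Type) [Field L] [NumberField L] [IsCMField L] (μ : HeckeCharacter L) (ξ : OneDimAutRepH L) (v : Pl L),
      (∀ w : PlacesOver L v, IsCMField.complexConj L • w.1 = w.1) → μ.IsUnitary →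
      (∀ x : Literature.NumberTheory.GaloisRepresentations.ideleGroup ↥(maximalRealSubfield L),
        μ (AdeleRing.ideleBaseChange (↥(maximalRealSubfield L)) L x) = quadraticHeckeCharCM L x) →
      ∀ [MeasurableSpace (HLoc L v)] [BorelSpace (HLoc L v)] [MeasurableSpace (Gqs L v)] [BorelSpace (Gqs L v)]
        (νHv : Measure (HLoc L v)) (νQv : Measure (Gqs L v))
        [νHv.IsHaarMeasure] [νHv.IsMulRightInvariant] [νQv.IsHaarMeasure] [νQv.IsMulRightInvariant],
      letI : ∀ a : HLoc L v, MeasurableSpace (HLoc L v ⧸ Subgroup.centralizer ({a} : Set (HLoc L v))) := fun _ => borel _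
      haveI : ∀ a : HLoc L v, BorelSpace (HLoc L v ⧸ Subgroup.centralizer ({a} : Set (HLoc L v))) := fun _ => ⟨rfl⟩
      letI : ∀ γ : Gqs L v, MeasurableSpace (Gqs L v ⧸ Subgroup.centralizer ({γ} : Set (Gqs L v))) := fun _ => borel _
      haveI : ∀ γ : Gqs L v, BorelSpace (Gqs L v ⧸ Subgroup.centralizer ({γ} : Set (Gqs L v))) := fun _ => ⟨rfl⟩
      ∀ (mHv : OrbitalMeasureFamily (HLoc L v)) (mQv : OrbitalMeasureFamily (Gqs L v)),
        mHv.IsCanonical (IsLocalGRegular L v) νHv →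
        mQv.IsCanonical (fun γ => IsRegularElt (γ.val : GL (Fin 3) (UnitaryGroup.LocalRing L v))) νQv →
        ∀ (π₁ πSt : IrrClass (HLoc L v)),
          HLengthTwoLabels L v
            (torusCharPair (conjLocal L (IsCMField.complexConj L) v) (cmLocalForm L 2 v) (cmLocalForm_eq_over L 2 v) 0
              ((torusLocalComponent L (IsCMField.complexConj L) v ξ.η).comp
                  (quotConj (conjLocal L (IsCMField.complexConj L) v) (conjLocal_conjLocal_cm L v)) *
                halfModulusChar (UnitaryGroup.LocalRing L v))
              (torusLocalComponent L (IsCMField.complexConj L) v ξ.ψ))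
            ((torusLocalComponent L (IsCMField.complexConj L) v ξ.ψ).comp (localDet (IsCMField.complexConj L) v (isUnit_antidiagOne_det L 1))) π₁ πSt →
          (∀ fH : HLoc L v → ℂ, IsLocSmooth fH → π₁.smoothTrace νHv fH = charDist (ξ.xiLocalChar v) νHv fH) →
          ∃ (μG : Measure (adelicGroupData (↥(maximalRealSubfield L)) L (IsCMField.complexConj L) 3 (qsForm L)).automorphicQuotient)
            (_ : (adelicGroupData (↥(maximalRealSubfield L)) L (IsCMField.complexConj L) 3 (qsForm L)).IsAutomorphicMeasure μG)
            (ι : Type) (_ : Finite ι) (loc : ι → ∀ u : Pl L, IrrClass (Gqs L u)) (m : ι → ℕ) (ε : ι → ℤ),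
            (∀ i, cmOccursInDiscreteSpectrum L 3 (qsForm L) μG (loc i) ∧ 0 < m i) ∧ (∀ i, ε i = 1 ∨ ε i = -1) ∧
            ∀ (fH : HLoc L v → ℂ) (φ : Gqs L v → ℂ), IsLocSmooth fH → IsLocSmooth φ →
              IsLocalDeltaTransfer L (qsForm L) v ((finExplicitCollection L (qsForm L) μ (finExplicitDelta_conj_left_all L (qsForm L) μ) (finExplicitDelta_conj_right_all L (qsForm L) μ)) v) mHv mQv fH φ →
              Summable (fun i : ι => (m i : ℂ) * (ε i : ℂ) * (loc i v).smoothTrace νQv φ) ∧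
                ∑' i : ι, (m i : ℂ) * (ε i : ℂ) * (loc i v).smoothTrace νQv φ = πSt.smoothTrace νHv fH) :
    E1St1383Letter := by
  intro L _ _ _ μ ξ v hv hμu hμq _ _ _ _ νHv νQv _ _ _ _ mHv mQv hmH hmQ π₁ πSt hlab hπ₁
  obtain ⟨μG, hμG, ι, hι, loc, m, ε, hocc, hε, hid⟩ := H L μ ξ v hv hμu hμq νHv νQv mHv mQv hmH hmQ π₁ πSt hlab hπ₁
  haveI := hμG
  exact exists_measure_kit_of_levelCut μG hμG hι loc m ε (fun i => (hocc i).1) (fun i => (hocc i).2) hε v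
    (fun 𝔨 => ∀ (fH : HLoc L v → ℂ) (φ : Gqs L v → ℂ), IsLocSmooth fH → IsLocSmooth φ →
      IsLocalDeltaTransfer L (qsForm L) v ((finExplicitCollection L (qsForm L) μ (finExplicitDelta_conj_left_all L (qsForm L) μ)
        (finExplicitDelta_conj_right_all L (qsForm L) μ)) v) mHv mQv fH φ →
      Summable (fun i : 𝔨.Idx => (𝔨.mult i : ℂ) * (𝔨.eps i : ℂ) * (𝔨.loc i v).smoothTrace νQv φ) ∧
        ∑' i : 𝔨.Idx, (𝔨.mult i : ℂ) * (𝔨.eps i : ℂ) * (𝔨.loc i v).smoothTrace νQv φ = πSt.smoothTrace νHv fH)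
    hid

end Summit.HodgeConjecture.HodgeConjecture.Cruxes.H413.K2E1StGlobKitOfLevelCut

end
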